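import Mathlib
import HarnessLib
import Summits.AnomalousDissipation.AnomalousDissipation.Theses.MarginalStabilityChain

/-!
# Sketch — crux-ideate stmt-AnomalousDissipation-3005 (ChainThesis), ideator 2, round 1

First-lemma signatures for the idea cards
* `drifting-frozen-states` (relative equilibria of a symmetric force as eternal witnesses), and
* `doppler-detuned-strain-arena` (exact ν-uniform windy cellular arena).
Nothing here is proved; the point is that the statements elaborate over tree declarations.
-/

namespace Summit.AnomalousDissipation.AnomalousDissipation.Cruxes.ChainThesis.Ideate2

open Literature.Analysis.FunctionSpaces Literature.Analysis.FunctionSpaces.Torus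
open Literature.Analysis.FluidPDE
open Summit.AnomalousDissipation.AnomalousDissipation.Theses.MarginalStabilityChain

/-- The flat three-torus (local notation). -/
local notation "𝕋³" => UnitAddTorus (Fin 3)
/-- Velocity values (local notation). -/
local notation "E³" => EuclideanSpace ℝ (Fin 3)

/-! ## Card A: drifting frozen states (relative equilibria) -/

/-- A RELATIVE EQUILIBRIUM of an `x₂`-invariant force: a smooth pattern `U` (pressure `P`) solving
the drifted steady Navier–Stokes system `-c ∂₂U + (U·∇)U = νΔU - ∇P + f`; the eternal solution
is `u(t,x) = U(x - c t e₂)` (steady for `c = 0`). -/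
def IsRelativeEquilibrium (ν c : ℝ) (f U : 𝕋³ → E³) (P : 𝕋³ → ℝ) : Prop :=
  IsSmooth U ∧ IsSmooth P ∧ IsDivFree U ∧
    ∀ x, -c • partialDeriv (2 : Fin 3) U x + convect U U x =
      ν • laplacian U x - gradient P x + f x

/-- The drifting space–time field `u(t,x) = U(x - c t e₂)` of a pattern `U`. -/
noncomputable def drift (c : ℝ) (U : 𝕋³ → E³) : ℝ → 𝕋³ → E³ :=
  fun t x => U (x + Pi.single (2 : Fin 3) (((-(c * t) : ℝ)) : UnitAddCircle))

/-- Same for the pressure. -/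
noncomputable def driftP (c : ℝ) (P : 𝕋³ → ℝ) : ℝ → 𝕋³ → ℝ :=
  fun t x => P (x + Pi.single (2 : Fin 3) (((-(c * t) : ℝ)) : UnitAddCircle))

/-- TRANSFER `C⁺` of card A: loud bounded relative equilibria of ONE `x₂`-invariant steady force
(energy and dissipation are those of the pattern; no time averaging needed). -/
def DriftingFrozenWitness : Prop :=
  ∃ f : 𝕋³ → E³, IsSmooth f ∧ IsDivFree f ∧ HasZeroMean f ∧
    (∀ (s : UnitAddCircle) (x : 𝕋³), f (x + Pi.single (2 : Fin 3) s) = f x) ∧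
    ∃ (ν c : ℕ → ℝ) (U : ℕ → 𝕋³ → E³) (P : ℕ → 𝕋³ → ℝ),
      (∀ j, 0 < ν j) ∧ Filter.Tendsto ν Filter.atTop (nhds 0) ∧
      (∀ j, IsRelativeEquilibrium (ν j) (c j) f (U j) (P j)) ∧
      (∃ E : ℝ, ∀ j, ∫ x, ‖U j x‖ ^ 2 ≤ E) ∧
      ∃ ε : ℝ, 0 < ε ∧ ∀ j, ε ≤ ν j * gradNormSq (U j)

/-- FIRST LEMMA of card A (glue, provable now from torus calculus: translation invariance of
`convect`/`laplacian`/`gradient`, chain rule in `t` through the `AddCircle` coercion, Cesàro mean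
of a constant, `gradNormSq = (eGradNormSq ·).toReal` on smooth slices): a relative equilibrium of an
`x₂`-invariant force is a classical solution on all of `ℝ` whose mean energy / mean dissipation are
the pattern's energy / dissipation. -/
def relativeEquilibrium_isClassical_univ : Prop :=
  ∀ (ν c : ℝ) (f U : 𝕋³ → E³) (P : 𝕋³ → ℝ),
    (∀ (s : UnitAddCircle) (x : 𝕋³), f (x + Pi.single (2 : Fin 3) s) = f x) →
    IsRelativeEquilibrium ν c f U P →
      IsClassicalNSSolutionOn Set.univ ν (fun _ => f) (drift c U) (driftP c P) ∧
      meanEnergy (drift c U) = ∫ x, ‖U x‖ ^ 2 ∧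
      meanDissipation ν (drift c U) = ν * gradNormSq U

/-- Composition target of card A: `C⁺ → ChainThesis` (immediate from the first lemma). -/
theorem chainThesis_of_driftingFrozenWitness
    (hglue : relativeEquilibrium_isClassical_univ) (h : DriftingFrozenWitness) : ChainThesis := by
  obtain ⟨f, hf, hdiv, hmean, hsym, ν, c, U, P, hν, hν0, hrel, ⟨E, hE⟩, ε, hε, hεle⟩ := h
  refine ⟨f, hf, hdiv, hmean, ν, fun j => drift (c j) (U j), fun j => driftP (c j) (P j), hν, hν0,
    fun j => (hglue (ν j) (c j) f (U j) (P j) hsym (hrel j)).1, ⟨E, fun j => ?_⟩, ε, hε, fun j => ?_⟩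
  · rw [(hglue (ν j) (c j) f (U j) (P j) hsym (hrel j)).2.1]; exact hE j
  · rw [(hglue (ν j) (c j) f (U j) (P j) hsym (hrel j)).2.2]; exact hεle j

/-- MOMENTUM-FLUX PINNING (card A, loudness test; provable now by averaging the `e₀`-component of
the relative-equilibrium equation over `(x₁, x₂)` for the Kolmogorov force `F sin(2πN x₁) e₀`):
informal — the plane-averaged Reynolds stress `τ(x₁) = ⟨U₁U₀⟩_{x₀,x₂}` satisfies
`τ' = F sin(2πN x₁) + ν Ū₀''`, hence `‖τ + F cos(2πN x₁)/(2πN) - const‖_{L²} ≤ ν^{1/2} (F E^{1/2})^{1/2}`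
along any family with `∫|U|² ≤ E`. Stated here only as the energy identity it rests on. -/
def relativeEquilibrium_energy_identity : Prop :=
  ∀ (ν c : ℝ) (f U : 𝕋³ → E³) (P : 𝕋³ → ℝ),
    (∀ (s : UnitAddCircle) (x : 𝕋³), f (x + Pi.single (2 : Fin 3) s) = f x) →
    IsRelativeEquilibrium ν c f U P →
      ν * gradNormSq U = ∫ x, inner ℝ (f x) (U x)

/-! ## Card B: exact Doppler-detuned strain arena -/

/-- FIRST LEMMA of card B (provable now; 2-D single-shell fields are steady Euler flows, the wind
does no work and detunes the Stokes resonance): for a planar (`x₂`-invariant, third component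
zero) divergence-free Stokes eigenfield `g` (`Δg = -λ g`) and a planar wind `m` (`m 2 = 0`), every
planar divergence-free mean-zero Stokes eigenfield `V` on the same shell solving the LINEAR swept
problem `(m·∇)V = νΔV + g` makes `U = m + V` an exact STEADY Navier–Stokes solution with force `g`,
for every `ν` (including `ν = 0`). Existence/uniqueness of `V` with `‖V̂(k)‖ = ‖ĝ(k)‖/|2πi k·m + 4π²ν|k|²|
≤ ‖ĝ(k)‖/(2π|k·m|)` (ν-uniform) is the detuning condition `k·m ≠ 0` on the shell. -/
def exactWindyCellularArena : Prop :=
  ∀ (lam ν : ℝ) (m : E³) (g V : 𝕋³ → E³),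
    m 2 = 0 →
    IsSmooth g → IsDivFree g → HasZeroMean g → (∀ x, laplacian g x = -lam • g x) →
    (∀ (s : UnitAddCircle) (x : 𝕋³), g (x + Pi.single (2 : Fin 3) s) = g x) → (∀ x, g x 2 = 0) →
    IsSmooth V → IsDivFree V → HasZeroMean V → (∀ x, laplacian V x = -lam • V x) →
    (∀ (s : UnitAddCircle) (x : 𝕋³), V (x + Pi.single (2 : Fin 3) s) = V x) → (∀ x, V x 2 = 0) →
    (∀ x, convect (fun _ => m) V x = ν • laplacian V x + g x) →
    ∃ P : 𝕋³ → ℝ, IsSmooth P ∧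
      IsClassicalNSSolutionOn Set.univ ν (fun _ => g) (fun _ x => m + V x) (fun _ => P)

/-- Card B, arena energy budget (provable now): the windy arena has ν-UNIFORMLY bounded energy and
`O(ν)` dissipation — it is the laminar SKELETON, not the witness:
`ν‖∇U‖² = ν λ ‖V‖² ≤ ν λ ‖g‖² / (2π min_k |k·m|)²`. Informal here; the Lean form would quantify the
Fourier support. -/
def windyArena_dissipation_vanishes : Prop := True

end Summit.AnomalousDissipation.AnomalousDissipation.Cruxes.ChainThesis.Ideate2
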